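import Summits.BirchSwinnertonDyer.BirchSwinnertonDyer.Theorems.Rank1ResidualX9MuTransfer
import Literature.NumberTheory.EllipticCurves.Rank1Residual.X10bMuInvariant
import HarnessLib

/-!
# Class X10b (`p = 3`, good ordinary, `E[3]` irreducible, `ρ̄_{E,3}` NOT surjective): the
# `μ`-transfer at `3`, TYPED, and the rank-`0` bridge to `BSD(E,3)` (cell `bsd-smallim`, seat `koly`,
# gen 3; memo HOME/koly/KOLY-MEMO.md v1.6 §5.7, scope note 5.7.3 (ii) and Remark 5.7.1′ (4))

HONEST FRAMING (cell `bsd-smallim`): companion of `Rank1ResidualX9MuTransfer.lean` for the cell's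
row A5 = X10b. The memo's Theorem 5.7.1 (one `E`-split rank-two Kolyvagin prime over `Λ/p` makes
the mod-`p` dual Selmer group finite once Kato's integral class is non-zero mod `p`) holds verbatim
at `p = 3` PROVIDED `3 ∤ #ρ̄_{E,3}(G_ℚ)` — automatic when `E[3]` is irreducible and `ρ̄_{E,3}` is
NOT surjective (images 3Ns, 3Nn of orders 8, 16; the scalar `−1` serves Sah's lemma, and
`ℚ(E[3]) ∩ ℚ(μ_{3^∞}) = ℚ(μ_3)`), Remark 5.7.1′ (4); for SURJECTIVE `ρ̄_{E,3}` the field-theoretic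
step fails as written (`SL₂(𝔽₃)^{ab} ≅ ℤ/3`) and nothing is claimed. With Kato's 17.13 at `p = 3`
(stated for `p ≠ 2`) this gives `μ(L_3(E)) = 0 ⟹ μ(X(E/ℚ_∞)) = 0` on X10b (memo 5.7.3 (ii)); the
`λ`-part / rational main conjecture at `3` is NOT supplied by the memo and enters below as the tree's
pointwise hypothesis `hrat` (fed e.g. by Yan–Zhu 2026 Thm. 4.9, PUB, flag `YZ26@3-BF-ERL-Ohta`,
`rationalMC_of_yanZhu`). This file asserts NOTHING about any curve:

* `KatoMuTransferThree` — the `p = 3`, non-surjective case of the `μ`-transfer as an OBLIGATION node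
  (`@[conjecture]`; paper-proved in the memo modulo refereeing; nothing asserted);
* `x10b_mu_eq_zero_of_katoMuTransferThree` — per pair: transfer ∧ unit coefficient ⟹ `D.mu = 0` for
  all cyclotomic data (the `hμ` binder of `X10bMuInvariant.lean`);
* `x10b_bsdp_rankZero_of_katoMuTransferThree` — KERNEL: on X10b in analytic rank `0`,
  `KatoMuTransferThree` ∧ the unit-coefficient certificate ∧ the rational main conjecture `hrat` ∧ the
  PUBLISHED binders of `bsdp_of_mu_eq_zero_of_rationalMC` ⟹ `BSDp W 3`;
* `x10b_bsdp_rankZero_of_katoMuTransferThree_of_yanZhu` — the same with `hrat` from Yan–Zhu.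

The rank-`1` half of X10b is not touched (as in `X10bMuInvariant.lean`). No pair or class is booked.
-/

-- the summit and its single problem are both named `BirchSwinnertonDyer` (registry layout D-0017)
set_option linter.dupNamespace false

set_option autoImplicit false

noncomputable section

open scoped Classical MatrixGroups ModularForm

open CongruenceSubgroup WeierstrassCurve Field
open Literature.NumberTheory.EllipticCurves Literature.NumberTheory.EllipticCurves.ModularForms
open Literature.NumberTheory.EllipticCurves.Rank1Residual (bsdp_of_mu_eq_zero_of_rationalMC
  rationalMC_of_yanZhu norm_periodRatio_eq_one_of_odd Surj GoodOrd Irr)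

namespace Summit.BirchSwinnertonDyer.BirchSwinnertonDyer.Rank1Residual

/-- **KOLY-MEMO v1.6 Cor. 5.7.2 / 5.7.3 (ii) at `p = 3` — the `μ`-transfer on X10b (cell theorem
on paper; OPEN obligation node in the kernel, nothing asserted).** For every globally minimal `W/ℚ`
with good ordinary reduction at `3`, `E[3]` irreducible and `ρ̄_{E,3}` NOT surjective (so
`3 ∤ #ρ̄_{E,3}(G_ℚ)`: images 3Ns/3Nn), and every newform `f` of `W`: one `3`-adic unit among the
coefficients of `L_3(f, α)` ("`μ(𝓛_3(E)) = 0`") forces `μ(X(E/ℚ_∞)) = 0` for every cyclotomic Selmer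
dual datum (`D.mu = 0`). Memo: Theorem 5.7.1 at `p = 3` (Remark 5.7.1′ (4): the scalar `−1 ∈ Ḡ`,
`Ḡ ∩ SL₂(𝔽₃)` of order prime to `3`, `C(q−1, 2) ≡ 0`, `−2 ≢ 0 (mod 3)`) + [Kato 2004, 12.6, 17.13
at `𝔭 ∋ 3`, `p ≠ 2`]. The prime is carried as a variable `p` with `p = 3` (the shape of `ClassX10`).
[cite: Kato2004Asterisque, Thm. 12.6 and 17.13 (p. 280)] [cite: GreenbergLNM1716, §1 Conj. 1.11] -/
@[conjecture] def KatoMuTransferThree : Prop :=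
  ∀ (W : WeierstrassCurve ℚ) [W.IsElliptic] [W.IsGloballyMinimal] (p : ℕ) [Fact p.Prime]
    {N : ℕ} [NeZero N] (f : CuspForm (Gamma0 N) 2),
    p = 3 → W.HasGoodReductionAtPrime p → ¬ (p : ℤ) ∣ W.frobeniusTrace p →
    W.HasIrreducibleModPGaloisRep p → ¬ W.HasSurjectiveModNGaloisRep p → IsNewformOf W f →
    (∃ n : ℕ, ‖PowerSeries.coeff n (padicLFunction f (unitRoot W p : ℚ_[p]))‖ = 1) →
    ∀ (κ : ZpExtension ℚ p) (γ : Field.absoluteGaloisGroup ℚ),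
      κ.IsCyclotomic → κ.IsTopGenerator γ → IsCyclotomicVariable p γ →
      ∀ D : W.SelmerDualData κ γ, D.mu = 0

/-- **Per X10b pair: transfer ∧ certificate ⟹ `μ(X) = 0` for all cyclotomic data at `3`** (the `hμ`
binder of `X10bMuInvariant.lean`), the certificate being stated for the newforms of `W` (one exists
by modularity, `hmodP`). `ClassX10 W p` supplies `p = 3`, good ordinary, irreducible; `hns` the
non-surjectivity that makes the pair X10b. [folklore] -/
theorem x10b_mu_eq_zero_of_katoMuTransferThree
    (hmodP : nonempty_modularParametrizationData) (hT3 : KatoMuTransferThree)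
    (W : WeierstrassCurve ℚ) [W.IsElliptic] [W.IsGloballyMinimal] (p : ℕ) [Fact p.Prime]
    (hX10 : Literature.NumberTheory.EllipticCurves.Rank1Residual.ClassX10 W p) (hns : ¬ Surj W 3)
    (hcertA : ∀ {N : ℕ} [NeZero N] (f : CuspForm (Gamma0 N) 2), IsNewformOf W f →
      ∃ n : ℕ, ‖PowerSeries.coeff n (padicLFunction f (unitRoot W p : ℚ_[p]))‖ = 1) :
    ∀ (κ : ZpExtension ℚ p) (γ : Field.absoluteGaloisGroup ℚ),
      κ.IsCyclotomic → κ.IsTopGenerator γ → IsCyclotomicVariable p γ →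
      ∀ D : W.SelmerDualData κ γ, D.mu = 0 := by
  intro κ γ hκ hγ hγ' D
  obtain ⟨hp3, ⟨hgood, hord⟩, hirr, -⟩ := id hX10
  subst hp3
  haveI : NeZero (W.conductorNorm ℤ) := ⟨(W.conductorNorm_pos_holds).ne'⟩
  obtain ⟨Dm⟩ := hmodP W
  exact hT3 W 3 Dm.f rfl hgood hord hirr hns Dm.isNewformOf (hcertA Dm.f Dm.isNewformOf) κ γ hκ hγ
    hγ' D

/-- **Class X10b, analytic rank `0`: `BSD(E,3)` from the `μ`-transfer (KERNEL bridge).** Inputs: the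
rational main conjecture for `(W, 3)` as the pointwise hypothesis `hrat` of `X10bMuInvariant.lean`
(Yan–Zhu 2026 Thm. 4.9 / any later source), the PUBLISHED binders of
`bsdp_of_mu_eq_zero_of_rationalMC` (Greenberg LNM 1716 Thm. 4.1 `hGr`, period units `h5`/`h3`,
modularity `hmodP`/`hmodL`, GZK `hGZK`), the cell input `KatoMuTransferThree` (memo §5.7 at `p = 3`),
and the finite certificate `hcertA` (a unit coefficient of `L_3(f, α)` for the newforms of `W`; the
`ϖ`-shape of the tree follows from `‖ϖ‖₃ = 1`, `norm_periodRatio_eq_one_of_odd`). Deduction: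
`x10b_mu_eq_zero_of_katoMuTransferThree` feeds `hμ` to `bsdp_of_mu_eq_zero_of_rationalMC`.
Nothing is booked: `KatoMuTransferThree` is an open node; `hrat` at `3` carries the flag of its source.
[cite: GreenbergLNM1716, Thm. 4.1 (p. 102) and §1 Conj. 1.11]
[cite: CastellaEtAl2021, Thm. 5.1.4 and its proof (§5.1.3)] -/
theorem x10b_bsdp_rankZero_of_katoMuTransferThree
    (W : WeierstrassCurve ℚ) [W.IsElliptic] [W.IsGloballyMinimal] (p : ℕ) [Fact p.Prime]
    (hrat : ∀ (κ : ZpExtension ℚ p) (γ : Field.absoluteGaloisGroup ℚ) {N : ℕ} [NeZero N]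
      (f : CuspForm (Gamma0 N) 2), κ.IsCyclotomic → κ.IsTopGenerator γ → IsCyclotomicVariable p γ →
      IsNewformOf W f → ∀ (D : W.SelmerDualData κ γ), D.IsTorsion ∧
        ∃ (g : IwasawaAlgebra p) (k : ℤ), D.charIdeal = Ideal.span {g} ∧
          iwasawaToPowerSeries p g =
            PowerSeries.C ((p : ℚ_[p]) ^ k) * padicLFunction f (unitRoot W p : ℚ_[p]))
    (hGr : greenberg_charValue_rankZero) (h5 : realPeriodRat_eq_unit_mul_plusPeriod)
    (h3 : realPeriodRat_eq_unit_mul_plusPeriod_three)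
    (hmodP : nonempty_modularParametrizationData) (hmodL : hasEntireLFunction_rat)
    (hGZK : rank_eq_analyticRank_of_analyticRank_le_one)
    (hT3 : KatoMuTransferThree)
    (hX10 : Literature.NumberTheory.EllipticCurves.Rank1Residual.ClassX10 W p) (hns : ¬ Surj W 3)
    (hr : W.analyticRank = 0)
    (hcertA : ∀ {N : ℕ} [NeZero N] (f : CuspForm (Gamma0 N) 2), IsNewformOf W f →
      ∃ n : ℕ, ‖PowerSeries.coeff n (padicLFunction f (unitRoot W p : ℚ_[p]))‖ = 1) :
    BSDp W p := by
  have hμ := x10b_mu_eq_zero_of_katoMuTransferThree hmodP hT3 W p hX10 hns hcertA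
  obtain ⟨hp3, ⟨hgood, hord⟩, hirr, -⟩ := id hX10
  subst hp3
  have hcert : ∀ [NeZero (W.conductorNorm ℤ)] (f : CuspForm (Gamma0 (W.conductorNorm ℤ)) 2),
      IsNewformOf W f → ∀ (ϖ : ℚ), (ϖ : ℝ) * W.realPeriodRat = plusPeriod f →
      ∃ n : ℕ, ‖PowerSeries.coeff n
        (PowerSeries.C (ϖ : ℚ_[3]) * padicLFunction f (unitRoot W 3 : ℚ_[3]))‖ = 1 := by
    intro _ f hf ϖ hϖeq
    obtain ⟨n, hn⟩ := hcertA f hf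
    refine ⟨n, ?_⟩
    rw [PowerSeries.coeff_C_mul, norm_mul,
      norm_periodRatio_eq_one_of_odd h5 h3 W 3 (by decide) hgood hirr f hf ϖ hϖeq, one_mul]
    exact hn
  exact bsdp_of_mu_eq_zero_of_rationalMC W 3 hrat hGr h5 h3 hmodP hmodL hGZK (by decide) hgood hord
    hirr hr hμ hcert

/-- **Class X10b, rank `0`: `BSD(E,3)` from the `μ`-transfer, with the rational main conjecture at `3`
supplied by Yan–Zhu 2026 Thm. 4.9** (named fact `YanZhu2026.thm49_charIdeal_eq_padicLFunction`,
PUB, flag `YZ26@3-BF-ERL-Ohta`; `rationalMC_of_yanZhu`). Every binder is a PUBLISHED named fact,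
the open node `KatoMuTransferThree`, or the finite certificate.
[cite: YanZhu2024MainConjNonCM, Thm. 4.9 (§4.4)] [cite: GreenbergLNM1716, Thm. 4.1 (p. 102)] -/
theorem x10b_bsdp_rankZero_of_katoMuTransferThree_of_yanZhu
    (W : WeierstrassCurve ℚ) [W.IsElliptic] [W.IsGloballyMinimal] (p : ℕ) [Fact p.Prime]
    (hYZ : YanZhu2026.thm49_charIdeal_eq_padicLFunction)
    (hGr : greenberg_charValue_rankZero) (h5 : realPeriodRat_eq_unit_mul_plusPeriod)
    (h3 : realPeriodRat_eq_unit_mul_plusPeriod_three)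
    (hmodP : nonempty_modularParametrizationData) (hmodL : hasEntireLFunction_rat)
    (hGZK : rank_eq_analyticRank_of_analyticRank_le_one)
    (hT3 : KatoMuTransferThree)
    (hX10 : Literature.NumberTheory.EllipticCurves.Rank1Residual.ClassX10 W p) (hns : ¬ Surj W 3)
    (hr : W.analyticRank = 0)
    (hcertA : ∀ {N : ℕ} [NeZero N] (f : CuspForm (Gamma0 N) 2), IsNewformOf W f →
      ∃ n : ℕ, ‖PowerSeries.coeff n (padicLFunction f (unitRoot W p : ℚ_[p]))‖ = 1) :
    BSDp W p := by
  obtain ⟨hp3, ⟨hgood, hord⟩, hirr, -⟩ := id hX10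
  have hp2 : p ≠ 2 := by omega
  have hgood' : W.HasGoodReductionAtPrime p := hp3 ▸ hgood
  have hord' : ¬ (p : ℤ) ∣ W.frobeniusTrace p := by subst hp3; exact hord
  have hirr' : W.HasIrreducibleModPGaloisRep p := by subst hp3; exact hirr
  exact x10b_bsdp_rankZero_of_katoMuTransferThree W p
    (rationalMC_of_yanZhu W p hYZ hp2 hgood' hord' hirr') hGr h5 h3 hmodP hmodL hGZK hT3 hX10 hns
    hr hcertA

end Summit.BirchSwinnertonDyer.BirchSwinnertonDyer.Rank1Residual
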